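import Mathlib

/-!
# `FeketeSOS.SublinearShadow` (stmt-ValiantsHypothesis-14990), line `Sketch`, reshape 6 — stub `stub_algebraicRep`

**WLOG algebraic coefficients.**  If `Σ_{i<s} c_i g_i² = F_p` over `ℂ`, then there is a representation
`Σ_{i<s} c'_i g'_i² = F_p` with the same number of squares, `supp g'_i ⊆ supp g_i`, and ALL coefficients `c'_i`,
`g'_{i,n}` algebraic over `ℚ`.  Proof: the representations with prescribed support pattern and degree bound are the
complex points of an affine variety defined over `ℚ` (the coefficient identities are polynomial equations with
rational coefficients in the unknowns `c_i, g_{i,n}`); a `ℚ`-variety with a complex point has a point over the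
algebraic closure `ℚ̄ ⊂ ℂ` of `ℚ` in `ℂ` (Hilbert's Nullstellensatz, `MvPolynomial.vanishingIdeal_zeroLocus_eq_radical`:
an empty zero locus over an algebraically closed field forces `1` into the ideal, which the complex point refutes).
Consequence for the crux: Pareto-minimal representations may be taken with algebraic coefficients, so every place of
the field of definition is a discrete valuation of a number field.  [folklore: Lefschetz principle / Nullstellensatz]
-/

namespace Summit.ValiantsHypothesis.ValiantsHypothesis.Theorems.SublinearShadowSketch

open Polynomial Finset
open scoped BigOperators

-- `Summit.ValiantsHypothesis.ValiantsHypothesis.…` is the tree's mandated single-conjunct layout (Sub = Summit).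
set_option linter.dupNamespace false

/-- Ring maps act on the Fekete sum coefficientwise (its coefficients are integers). -/
theorem alr_map_fekete {R S : Type} [CommRing R] [CommRing S] (f : R →+* S) (p : ℕ) [Fact p.Prime] :
    (∑ m ∈ Finset.range p, C ((legendreSym p m : ℤ) : R) * X ^ m).map f
      = ∑ m ∈ Finset.range p, C ((legendreSym p m : ℤ) : S) * X ^ m := by
  rw [Polynomial.map_sum]
  refine Finset.sum_congr rfl fun m _ => ?_
  rw [Polynomial.map_mul, Polynomial.map_pow, map_C, map_X, map_intCast]

/-- Ring maps act on a weighted square of a coefficient-vector polynomial coefficientwise. -/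
theorem alr_map_term {R S : Type} [CommRing R] [CommRing S] (f : R →+* S) (x : R) {N : ℕ}
    (y : Fin (N + 1) → R) :
    (C x * (∑ a : Fin (N + 1), C (y a) * X ^ (a : ℕ)) ^ 2).map f
      = C (f x) * (∑ a : Fin (N + 1), C (f (y a)) * X ^ (a : ℕ)) ^ 2 := by
  rw [Polynomial.map_mul, Polynomial.map_pow, map_C, Polynomial.map_sum]
  congr 2
  refine Finset.sum_congr rfl fun a _ => ?_
  rw [Polynomial.map_mul, Polynomial.map_pow, map_C, map_X]

/-- Coefficients of a polynomial given by a coefficient vector of length `N + 1`. -/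
theorem alr_coeff_finSum {R : Type} [Semiring R] {N : ℕ} (y : Fin (N + 1) → R) (n : ℕ) :
    (∑ a : Fin (N + 1), C (y a) * X ^ (a : ℕ)).coeff n = if hn : n ≤ N then y ⟨n, Nat.lt_succ_of_le hn⟩ else 0 := by
  rw [finsetSum_coeff]
  simp only [coeff_C_mul_X_pow]
  by_cases hn : n ≤ N
  · rw [dif_pos hn, Finset.sum_eq_single ⟨n, Nat.lt_succ_of_le hn⟩]
    · simp
    · intro b _ hb
      rw [if_neg]
      intro h
      exact hb (Fin.ext h.symm)
    · intro h; exact absurd (Finset.mem_univ _) h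
  · rw [dif_neg hn]
    refine Finset.sum_eq_zero fun b _ => ?_
    rw [if_neg]
    intro h
    exact hn (h ▸ Nat.le_of_lt_succ b.2)

/-- A polynomial of degree `≤ N` is the polynomial of its coefficient vector of length `N + 1`. -/
theorem alr_eq_finSum {R : Type} [Semiring R] {N : ℕ} (g : R[X]) (hg : g.natDegree ≤ N) :
    g = ∑ a : Fin (N + 1), C (g.coeff a) * X ^ (a : ℕ) := by
  ext n
  rw [alr_coeff_finSum]
  split_ifs with hn
  · rfl
  · exact coeff_eq_zero_of_natDegree_lt (by omega)

/-- **Stub (W0): WLOG algebraic coefficients** (Nullstellensatz / Lefschetz).  A complex representation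
`Σ_{i<s} c_i g_i² = F_p` can be replaced by one with the same number of squares, supports `supp g'_i ⊆ supp g_i`, and
all coefficients algebraic over `ℚ`. [folklore] -/
theorem stub_algebraicRep (p : ℕ) [Fact p.Prime] (s : ℕ) (c : Fin s → ℂ) (g : Fin s → ℂ[X])
    (hrep : (∑ i, C (c i) * g i ^ 2) = ∑ m ∈ Finset.range p, C ((legendreSym p m : ℤ) : ℂ) * X ^ m) :
    ∃ (c' : Fin s → ℂ) (g' : Fin s → ℂ[X]),
      (∀ i, IsAlgebraic ℚ (c' i)) ∧ (∀ i n, IsAlgebraic ℚ ((g' i).coeff n)) ∧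
      (∀ i, (g' i).support ⊆ (g i).support) ∧
      (∑ i, C (c' i) * g' i ^ 2) = ∑ m ∈ Finset.range p, C ((legendreSym p m : ℤ) : ℂ) * X ^ m := by
  classical
  -- a common degree bound and the unknowns
  set N : ℕ := Finset.univ.sup fun i => (g i).natDegree with hN
  have hdegN : ∀ i, (g i).natDegree ≤ N := fun i => Finset.le_sup (f := fun i => (g i).natDegree) (Finset.mem_univ i)
  haveI hKclosed : IsAlgClosed (algebraicClosure ℚ ℂ) := (algebraicClosure.isAlgClosure ℚ ℂ).isAlgClosed
  -- the GENERIC representation polynomial in the unknowns `c_i = X (inl i)`, `g_{i,a} = X (inr (i,a))` (`a ≤ N`)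
  set G : Polynomial (MvPolynomial (Fin s ⊕ (Fin s × Fin (N + 1))) ℚ) :=
    (∑ i : Fin s, C (MvPolynomial.X (Sum.inl i)) *
        (∑ a : Fin (N + 1), C (MvPolynomial.X (Sum.inr (i, a))) * X ^ (a : ℕ)) ^ 2) -
      ∑ m ∈ Finset.range p, C ((legendreSym p m : ℤ) : MvPolynomial (Fin s ⊕ (Fin s × Fin (N + 1))) ℚ) * X ^ m
    with hG
  have hmapG : ∀ (R : Type) [CommRing R] [Algebra ℚ R] (z : Fin s ⊕ (Fin s × Fin (N + 1)) → R),
      G.map (MvPolynomial.aeval z).toRingHom =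
        (∑ i : Fin s, C (z (Sum.inl i)) * (∑ a : Fin (N + 1), C (z (Sum.inr (i, a))) * X ^ (a : ℕ)) ^ 2) -
          ∑ m ∈ Finset.range p, C ((legendreSym p m : ℤ) : R) * X ^ m := by
    intro R _ _ z
    rw [hG, Polynomial.map_sub, alr_map_fekete, Polynomial.map_sum]
    congr 1
    refine Finset.sum_congr rfl fun i _ => ?_
    rw [alr_map_term]
    simp only [AlgHom.toRingHom_eq_coe, RingHom.coe_coe, MvPolynomial.aeval_X]
  -- the ideal of the representation variety with the support pattern of `g`
  set Sset : Set (MvPolynomial (Fin s ⊕ (Fin s × Fin (N + 1))) ℚ) :=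
    Set.range (fun m : ℕ => G.coeff m) ∪
      {q | ∃ (i : Fin s) (a : Fin (N + 1)), (a : ℕ) ∉ (g i).support ∧ q = MvPolynomial.X (Sum.inr (i, a))}
    with hSset
  set I : Ideal (MvPolynomial (Fin s ⊕ (Fin s × Fin (N + 1))) ℚ) := Ideal.span Sset with hI
  -- the complex point
  set z₀ : Fin s ⊕ (Fin s × Fin (N + 1)) → ℂ := fun v => match v with
    | Sum.inl i => c i
    | Sum.inr (i, a) => (g i).coeff a with hz₀
  have hz₀gen : ∀ q ∈ Sset, MvPolynomial.aeval z₀ q = 0 := by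
    rintro q (⟨m, rfl⟩ | ⟨i, a, ha, rfl⟩)
    · have hmap : G.map (MvPolynomial.aeval z₀).toRingHom = 0 := by
        rw [hmapG, sub_eq_zero, ← hrep]
        refine Finset.sum_congr rfl fun i _ => ?_
        change C (c i) * (∑ a : Fin (N + 1), C ((g i).coeff a) * X ^ (a : ℕ)) ^ 2 = C (c i) * g i ^ 2
        rw [← alr_eq_finSum (g i) (hdegN i)]
      have h := congrArg (fun P => Polynomial.coeff P m) hmap
      simp only [Polynomial.coeff_map, coeff_zero] at h
      exact h
    · rw [MvPolynomial.aeval_X]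
      exact notMem_support_iff.mp ha
  have hz₀I : ∀ q ∈ I, MvPolynomial.aeval z₀ q = 0 := fun q hq => by
    refine Submodule.span_induction (p := fun q _ => MvPolynomial.aeval z₀ q = 0) ?_ ?_ ?_ ?_ hq
    · exact hz₀gen
    · exact map_zero _
    · intro x y _ _ hx hy; rw [map_add, hx, hy, add_zero]
    · intro a x _ hx; rw [smul_eq_mul, map_mul, hx, mul_zero]
  -- Nullstellensatz: a point over `K = ℚ̄ ∩ ℂ`
  have hne : (MvPolynomial.zeroLocus (algebraicClosure ℚ ℂ) I).Nonempty := by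
    by_contra hempty
    rw [Set.not_nonempty_iff_eq_empty] at hempty
    have hrad : I.radical = ⊤ := by
      rw [← MvPolynomial.vanishingIdeal_zeroLocus_eq_radical (K := algebraicClosure ℚ ℂ) I, hempty]
      exact MvPolynomial.vanishingIdeal_empty
    have h1 : (1 : MvPolynomial (Fin s ⊕ (Fin s × Fin (N + 1))) ℚ) ∈ I := by
      have h1r : (1 : MvPolynomial _ ℚ) ∈ I.radical := hrad ▸ Submodule.mem_top
      obtain ⟨n, hn⟩ := h1r
      rwa [one_pow] at hn
    have := hz₀I 1 h1
    rw [map_one] at this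
    exact one_ne_zero this
  obtain ⟨y, hy⟩ := hne
  have hyS : ∀ q ∈ Sset, MvPolynomial.aeval y q = 0 := fun q hq => hy q (Ideal.subset_span hq)
  -- the algebraic representation over `K`, pushed into `ℂ`
  set ι : algebraicClosure ℚ ℂ →+* ℂ := algebraMap (algebraicClosure ℚ ℂ) ℂ with hι
  set cK : Fin s → algebraicClosure ℚ ℂ := fun i => y (Sum.inl i) with hcK
  set GK : Fin s → (algebraicClosure ℚ ℂ)[X] := fun i => ∑ a : Fin (N + 1), C (y (Sum.inr (i, a))) * X ^ (a : ℕ) with hGK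
  have hrepK : (∑ i, C (cK i) * GK i ^ 2)
      = ∑ m ∈ Finset.range p, C ((legendreSym p m : ℤ) : algebraicClosure ℚ ℂ) * X ^ m := by
    rw [← sub_eq_zero, ← hmapG _ y]
    refine Polynomial.ext fun m => ?_
    rw [Polynomial.coeff_map, coeff_zero]
    exact hyS _ (Or.inl ⟨m, rfl⟩)
  refine ⟨fun i => ι (cK i), fun i => (GK i).map ι, ?_, ?_, ?_, ?_⟩
  · intro i
    exact mem_algebraicClosure_iff.mp (cK i).2
  · intro i n
    rw [Polynomial.coeff_map]
    exact mem_algebraicClosure_iff.mp ((GK i).coeff n).2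
  · intro i n hn
    rw [Polynomial.support_map_of_injective _ ι.injective, mem_support_iff, hGK, alr_coeff_finSum] at hn
    by_contra hns
    split_ifs at hn with hle
    · exact hn (by
        have := hyS _ (Or.inr ⟨i, ⟨n, Nat.lt_succ_of_le hle⟩, hns, rfl⟩)
        rwa [MvPolynomial.aeval_X] at this)
    · exact hn rfl
  · have h := congrArg (Polynomial.map ι) hrepK
    rw [Polynomial.map_sum, alr_map_fekete] at h
    simp only [Polynomial.map_mul, Polynomial.map_pow, map_C] at h
    exact h

end Summit.ValiantsHypothesis.ValiantsHypothesis.Theorems.SublinearShadowSketch
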